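import Mathlib.Analysis.Complex.Exponential
import Mathlib.Algebra.Order.Floor.Defs
import Mathlib.Order.Filter.AtTopBot.Basic
import HarnessLib

/-!
# Route `LuscherReduction`, item `DressedRitz` (stmt-QuantumFields-20205), line «polyakovlift» r7, stub S-PSCAL″ — SMALLNESS TOOLS for the quantifier shell
# (F9 layer D5b, part 2; LEAD prover ym-lead-20205-polyakovlift g2)

Elementary real inequalities in the exact shapes the shell of `PScalingExistsForL` uses to choose `lam0` (conditions in `Λ` alone) and `L0(lam)` (conditions in
`L`, uniformly for `Λ ∈ [lam, 2lam]`): `smallΛ_mul_pow` (`M·Λ^{q+1} ≤ Λ^q` once `(M+1)Λ ≤ 1`, `Λ ≥ 0`), `smallΛ_exp_neg_div` (`e^{−b/Λ} ≤ n!(Λ/b)ⁿ`),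
`smallΛ_exp_neg_div_mul` (`P·e^{−b/Λ} ≤ Λ^q` once `P·(q+1)!·Λ ≤ b^{q+1}`), `largeL_div_le` (`M/L ≤ t` for `L ≥ ⌈M/t⌉₊`), `exp_div_le_exp_div_of_le`
(`e^{c/Λ} ≤ e^{c/lam}` on `lam ≤ Λ`), `pow_window` (`lam^q ≤ Λ^q ≤ (2lam)^q`).

HONEST FRAMING: arithmetic; nothing here bears on infinite volume, the continuum limit or the Clay gap.
References: M. Lüscher, NPB 219 (1983) 233 [cite: Luscher1983, §2].
-/

set_option autoImplicit false

noncomputable section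

open Real

namespace Summit.QuantumFields.YangMills.Theorems.FemtoTransferGap.PScal

/-- `M·Λ^{q+1} ≤ Λ^q` as soon as `(M+1)·Λ ≤ 1` (`M ≥ 0`, `Λ ≥ 0`). [folklore] -/
theorem smallΛ_mul_pow {M Λ : ℝ} (hΛ : 0 ≤ Λ) (hΛM : (M + 1) * Λ ≤ 1) (q : ℕ) : M * Λ ^ (q + 1) ≤ Λ ^ q := by
  have h1 : M * Λ ≤ 1 := by nlinarith
  calc M * Λ ^ (q + 1) = (M * Λ) * Λ ^ q := by ring
    _ ≤ 1 * Λ ^ q := mul_le_mul_of_nonneg_right h1 (pow_nonneg hΛ q)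
    _ = Λ ^ q := one_mul _

/-- `e^{−b/Λ} ≤ n!·(Λ/b)ⁿ` (`b, Λ > 0`). [folklore] -/
theorem smallΛ_exp_neg_div {b Λ : ℝ} (hb : 0 < b) (hΛ : 0 < Λ) (n : ℕ) : Real.exp (-(b / Λ)) ≤ (n.factorial : ℝ) * (Λ / b) ^ n := by
  have hx : 0 < b / Λ := div_pos hb hΛ
  have h0 := Real.pow_div_factorial_le_exp (b / Λ) hx.le n
  have hfac : (0 : ℝ) < n.factorial := by exact_mod_cast Nat.factorial_pos n
  rw [Real.exp_neg, inv_le_comm₀ (Real.exp_pos _) (by positivity)]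
  calc ((n.factorial : ℝ) * (Λ / b) ^ n)⁻¹ = (b / Λ) ^ n / n.factorial := by
        rw [mul_inv, ← inv_pow, inv_div]; ring
    _ ≤ Real.exp (b / Λ) := h0

/-- `P·e^{−b/Λ} ≤ Λ^q` as soon as `P·(q+1)!·Λ ≤ b^{q+1}` (`P ≥ 0`, `0 < Λ`, `0 < b`). [folklore] -/
theorem smallΛ_exp_neg_div_mul {P b Λ : ℝ} (hP : 0 ≤ P) (hb : 0 < b) (hΛ : 0 < Λ) (q : ℕ)
    (h : P * ((q + 1).factorial : ℝ) * Λ ≤ b ^ (q + 1)) : P * Real.exp (-(b / Λ)) ≤ Λ ^ q := by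
  have h1 := smallΛ_exp_neg_div hb hΛ (q + 1)
  have hbq : 0 < b ^ (q + 1) := pow_pos hb _
  calc P * Real.exp (-(b / Λ)) ≤ P * (((q + 1).factorial : ℝ) * (Λ / b) ^ (q + 1)) := mul_le_mul_of_nonneg_left h1 hP
    _ = (P * ((q + 1).factorial : ℝ) * Λ) * Λ ^ q / b ^ (q + 1) := by rw [div_pow]; ring
    _ ≤ b ^ (q + 1) * Λ ^ q / b ^ (q + 1) := by
        exact div_le_div_of_nonneg_right (mul_le_mul_of_nonneg_right h (pow_nonneg hΛ.le q)) hbq.le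
    _ = Λ ^ q := by field_simp

/-- `M/L ≤ t` for every `L ≥ ⌈M/t⌉₊` (`t > 0`, `L > 0`). [folklore] -/
theorem largeL_div_le {M t : ℝ} (ht : 0 < t) {L : ℕ} (hL : ⌈M / t⌉₊ ≤ L) (hL0 : 0 < L) : M / (L : ℝ) ≤ t := by
  have hLr : (0 : ℝ) < L := by exact_mod_cast hL0
  have h1 : M / t ≤ (⌈M / t⌉₊ : ℝ) := Nat.le_ceil _
  have h2 : (⌈M / t⌉₊ : ℝ) ≤ L := by exact_mod_cast hL
  rw [div_le_iff₀ hLr]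
  have := (div_le_iff₀ ht).1 (h1.trans h2)
  linarith

/-- `e^{c/Λ} ≤ e^{c/lam}` for `0 ≤ c`, `0 < lam ≤ Λ`. [folklore] -/
theorem exp_div_le_exp_div_of_le {c lam Λ : ℝ} (hc : 0 ≤ c) (hlam : 0 < lam) (h : lam ≤ Λ) : Real.exp (c / Λ) ≤ Real.exp (c / lam) :=
  Real.exp_le_exp.2 (div_le_div_of_nonneg_left hc hlam h)

/-- On the window `lam ≤ Λ ≤ 2lam`: `lam^q ≤ Λ^q ≤ 2^q·lam^q`. [folklore] -/
theorem pow_window {lam Λ : ℝ} (hlam : 0 < lam) (h1 : lam ≤ Λ) (h2 : Λ ≤ 2 * lam) (q : ℕ) :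
    lam ^ q ≤ Λ ^ q ∧ Λ ^ q ≤ 2 ^ q * lam ^ q := by
  refine ⟨pow_le_pow_left₀ hlam.le h1 q, ?_⟩
  rw [← mul_pow]
  exact pow_le_pow_left₀ (hlam.le.trans h1) h2 q

end Summit.QuantumFields.YangMills.Theorems.FemtoTransferGap.PScal

end
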